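import Summits.ResolutionOfSingularities.ResolutionOfSingularities.Theorems.FrobeniusLadderFInjectiveMacaulayficationDiagonalCIPair
import HarnessLib

/-!
# (U-i)/(U-ii) DIAGONAL PAIRS WITH UNEQUAL EXPONENTS `(Σ cᵢxᵢ^{aᵢ}, Σ dᵢxᵢ^{bᵢ})`: Khovanskii non-degeneracy and regularity off the vertex FROM THE FACE / SUPPORT TRUNCATIONS
# (crux `FInjectiveMacaulayfication` stmt-ResolutionOfSingularities-15315, chain w45a; res-L1-w45a-plan-1 RULINGs R23.25 (β) / R23.28 (2) «UNEQUAL-SUPPORT generics (i) Khovanskii-ND for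
# NON-HOMOTHETIC diagonal supports — state the per-weight condition on the pair of initial forms honestly, general n — (ii) off-vertex regularity for unequal exponents»; seat
# res-L1-w45a-stub-2 g13)

[OURS · L1 W4.5a] Support file (`--supports stmt-ResolutionOfSingularities-15315 --as helper`); def-free; UNCONDITIONAL; no named fact, no sorry; NOT a statement of any manuscript;
replaces the role of NO printed item. Nothing of the crux is proved. AI-written (AI review weaker than expert review).

SETTING. `F₀ = Σᵢ cᵢ xᵢ^{aᵢ}`, `F₁ = Σᵢ dᵢ xᵢ^{bᵢ}` in `n` variables, ALL `cᵢ, dᵢ ≠ 0`, exponents `aᵢ, bᵢ ≥ 1` non-zero in the field — but `a ≠ b` allowed (the Newton simplices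
`conv{aᵢeᵢ}` and `conv{bᵢeᵢ}` need not be homothetic). For a weight `w` write `A(w) = argminᵢ wᵢaᵢ`, `B(w) = argminᵢ wᵢbᵢ` (the vertex sets of the `w`-faces), so
`in_w F₀ = Σ_{A(w)} cᵢxᵢ^{aᵢ}`, `in_w F₁ = Σ_{B(w)} dᵢxᵢ^{bᵢ}`. For `S ⊆ {0..n−1}` the TRUNCATED PAIR is `(Σ_{S} cᵢxᵢ^{aᵢ}, Σ_{S} dᵢxᵢ^{bᵢ})` and its `(i, j)`-minor at `ξ` is
`M_{ij}(ξ) = aᵢcᵢξᵢ^{aᵢ−1}·bⱼdⱼξⱼ^{bⱼ−1} − aⱼcⱼξⱼ^{aⱼ−1}·bᵢdᵢξᵢ^{bᵢ−1}`.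
* §1 plumbing: `wdeg_single`, evaluation of face sums / their partials as sums over the vertex INDEX set.
* §2 ★ `ciNondegenerate_of_faces` — **THE HONEST PER-WEIGHT CONDITION.** If `A(w) ≠ B(w)` the gradient rows of the two initial forms have different supports on the torus and are
  independent for free; if `A(w) = B(w) = S` is a single vertex, `in_w F₀ = cᵢxᵢ^{aᵢ}` has no torus zero; so Khovanskii non-degeneracy along EVERY positive weight follows from:
  for every `S` with `|S| ≥ 2` on which the exponent vectors are PROPORTIONAL (`aᵢbⱼ = aⱼbᵢ` on `S` — only such `S` can be a common vertex set) and every torus point `q` with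
  `Σ_S cᵢqᵢ^{aᵢ} = Σ_S dᵢqᵢ^{bᵢ} = 0`, some minor `M_{ij}(q) ≠ 0` (`i, j ∈ S`). For `a = b` this is ✓`DiagonalCIPair.ciNondegenerate_pair` (the minors are `aᵢaⱼ(cᵢdⱼ − cⱼdᵢ)·…`).
* §3 `det_pair_general`, `mk_X_ne_zero_pair_general` (`x̄ᵥ ≠ 0` when all `aᵢ, bᵢ ≥ 2`).
* §4 ★ `isRegularLocalRing_off_vertex_of_points` — `(k[x]/(F₀, F₁))_Q` is REGULAR at every prime `Q ⊉ (x̄)` provided: for every field `L ⊇ k`, every non-empty `S` and every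
  `ξ ∈ Lⁿ` with `ξᵢ ≠ 0` on `S` and `Σ_S cᵢξᵢ^{aᵢ} = Σ_S dᵢξᵢ^{bᵢ} = 0`, some `M_{ij}(ξ) ≠ 0` (`i, j ∈ S`) — applied to `L = κ(Q)`, `ξ = x̄`, `S = {i : xᵢ ∉ Q}` (exponents `≥ 2`
  kill the columns off `S`), then ✓`CIJacobian.ci_clause_of_det_not_mem`.
The two-ratio family (`bᵢ = aᵢ` on `P`, `bᵢ = 2aᵢ` on `Q`) discharges both conditions in the companion file `…TwoRatioDiagonalPair`.
[cite: CuetoPopescupampuStepanov2023, Def. 4.2 (p. 12)] [cite: BoubakriGreuelMarkwig2010, §3 (p. 10)] [cite: Matsumura1987, Thm. 30.4 (ii)]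
-/

-- single-problem summit: the doubled namespace component is forced
set_option linter.dupNamespace false

noncomputable section

open MvPolynomial

namespace Summit.ResolutionOfSingularities.ResolutionOfSingularities.Theorems.FInjectiveMacaulayfication.DiagonalPairTruncations

open Summit.ResolutionOfSingularities.ResolutionOfSingularities.Theorems.FInjectiveMacaulayfication
open Literature.AlgebraicGeometry.Resolution Literature.AlgebraicGeometry.Resolution.BoubakriGreuelMarkwig CINondegenerate DiagonalCIPair

variable {K : Type} [Field K] {n : ℕ}

/-! ## §1 Plumbing: weights of pure powers; face sums and their partials as sums over the vertex index set -/

/-- `wdeg w (N·eᵢ) = wᵢ·N`. [plumbing] -/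
theorem wdeg_single (w : Fin n → ℝ) (i : Fin n) (N : ℕ) : wdeg w (Finsupp.single i N) = w i * N := by
  unfold wdeg pairing expPt
  rw [Finset.sum_eq_single i (fun j _ hji => by rw [Finsupp.single_apply, if_neg (Ne.symm hji), Nat.cast_zero, mul_zero])
    (fun h => (h (Finset.mem_univ i)).elim), Finsupp.single_apply, if_pos rfl]

/-- `i ↦ aᵢeᵢ` is injective (`aᵢ ≠ 0`). [plumbing] -/
theorem single_injective (a : Fin n → ℕ) (ha : ∀ i, a i ≠ 0) : Function.Injective fun i : Fin n => Finsupp.single i (a i) := by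
  intro i j h
  rcases (Finsupp.single_eq_single_iff _ _ _ _).mp h with ⟨hij, -⟩ | ⟨hi, -⟩
  · exact hij
  · exact (ha i hi).elim

/-- A set `Φ` of pure powers `aᵢeᵢ` is the image of its vertex INDEX set `{i : aᵢeᵢ ∈ Φ}`. [plumbing] -/
theorem eq_image_filter (a : Fin n → ℕ) (Φ : Finset (Fin n →₀ ℕ)) (hΦ : ∀ β ∈ Φ, ∃ i, β = Finsupp.single i (a i))
    [DecidablePred fun i : Fin n => Finsupp.single i (a i) ∈ Φ] :
    Φ = (Finset.univ.filter fun i : Fin n => Finsupp.single i (a i) ∈ Φ).image fun i => Finsupp.single i (a i) := by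
  classical
  ext β
  simp only [Finset.mem_image, Finset.mem_filter, Finset.mem_univ, true_and]
  constructor
  · intro hβ
    obtain ⟨i, rfl⟩ := hΦ β hβ
    exact ⟨i, hβ, rfl⟩
  · rintro ⟨i, hi, rfl⟩
    exact hi

/-- The face sum of a diagonal polynomial over a set of pure powers `Φ`, evaluated at `q`, is `Σ_{i : aᵢeᵢ ∈ Φ} cᵢ qᵢ^{aᵢ}`. [plumbing] -/
theorem eval_faceSum (a : Fin n → ℕ) (ha : ∀ i, a i ≠ 0) (c : Fin n → K) (Φ : Finset (Fin n →₀ ℕ)) (hΦ : ∀ β ∈ Φ, ∃ i, β = Finsupp.single i (a i))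
    [DecidablePred fun i : Fin n => Finsupp.single i (a i) ∈ Φ] (q : Fin n → K) :
    MvPolynomial.eval q (∑ α ∈ Φ, monomial α (coeff α (∑ m : Fin n, monomial (Finsupp.single m (a m)) (c m)))) =
      ∑ i ∈ Finset.univ.filter (fun i : Fin n => Finsupp.single i (a i) ∈ Φ), c i * q i ^ a i := by
  classical
  conv_lhs => rw [eq_image_filter a Φ hΦ]
  rw [Finset.sum_image fun i _ j _ h => single_injective a ha h, map_sum]
  refine Finset.sum_congr rfl fun i _ => ?_
  rw [coeff_diag_single a ha c i, eval_monomial, Finsupp.prod_single_index (by simp)]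

/-- `∂ⱼ` of a face sum over `Φ ∌ aⱼeⱼ` vanishes at every point. [plumbing] -/
theorem eval_pderiv_faceSum_of_not_mem (a : Fin n → ℕ) (c : Fin n → K) (Φ : Finset (Fin n →₀ ℕ)) (hΦ : ∀ β ∈ Φ, ∃ i, β = Finsupp.single i (a i))
    (j : Fin n) (hj : Finsupp.single j (a j) ∉ Φ) (q : Fin n → K) :
    MvPolynomial.eval q (pderiv j (∑ α ∈ Φ, monomial α (coeff α (∑ i : Fin n, monomial (Finsupp.single i (a i)) (c i))))) = 0 := by
  classical
  rw [map_sum, map_sum]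
  refine Finset.sum_eq_zero fun β hβ => ?_
  obtain ⟨i, rfl⟩ := hΦ β hβ
  have hij : i ≠ j := fun h => hj (h ▸ hβ)
  rw [pderiv_monomial, Finsupp.single_apply, if_neg hij, Nat.cast_zero, mul_zero, monomial_zero, map_zero]

/-- The gradient row of a face sum at `q`: `cⱼaⱼqⱼ^{aⱼ−1}` on the vertex index set, `0` off it. [plumbing] -/
theorem eval_pderiv_faceSum_ite (a : Fin n → ℕ) (ha : ∀ i, a i ≠ 0) (c : Fin n → K) (Φ : Finset (Fin n →₀ ℕ))
    (hΦ : ∀ β ∈ Φ, ∃ i, β = Finsupp.single i (a i)) [DecidablePred fun i : Fin n => Finsupp.single i (a i) ∈ Φ] (j : Fin n) (q : Fin n → K) :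
    MvPolynomial.eval q (pderiv j (∑ α ∈ Φ, monomial α (coeff α (∑ i : Fin n, monomial (Finsupp.single i (a i)) (c i))))) =
      if Finsupp.single j (a j) ∈ Φ then c j * ((a j : K) * q j ^ (a j - 1)) else 0 := by
  split_ifs with hj
  · exact eval_pderiv_faceSum a c Φ hΦ j hj ha q
  · exact eval_pderiv_faceSum_of_not_mem a c Φ hΦ j hj q

/-- Two vertices `aᵢeᵢ, aⱼeⱼ` of the SAME `w`-face have equal weights `wᵢaᵢ = wⱼaⱼ`. [plumbing] -/
theorem weight_eq_of_mem_face (a : Fin n → ℕ) (c : Fin n → K) (w : Fin n → ℝ) (Φ : Finset (Fin n →₀ ℕ))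
    (hΦ : Φ = (∑ i : Fin n, monomial (Finsupp.single i (a i)) (c i)).support.filter
      (fun α => ∀ β ∈ (∑ i : Fin n, monomial (Finsupp.single i (a i)) (c i)).support, wdeg w α ≤ wdeg w β))
    (i j : Fin n) (hi : Finsupp.single i (a i) ∈ Φ) (hj : Finsupp.single j (a j) ∈ Φ) : w i * a i = w j * a j := by
  rw [hΦ, Finset.mem_filter] at hi hj
  rw [← wdeg_single, ← wdeg_single]
  exact le_antisymm (hi.2 _ hj.1) (hj.2 _ hi.1)

/-! ## §2 ★ Khovanskii non-degeneracy from the common-face truncations -/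

set_option maxHeartbeats 800000 in
-- the case analysis on the two vertex sets is long but elementary
/-- ★ **KHOVANSKII NON-DEGENERACY OF A DIAGONAL PAIR WITH UNEQUAL EXPONENTS — THE HONEST PER-WEIGHT CONDITION.** `F₀ = Σ cᵢxᵢ^{aᵢ}`, `F₁ = Σ dᵢxᵢ^{bᵢ}` (`n ≥ 1`; all
`cᵢ, dᵢ ≠ 0`; `aᵢ, bᵢ ≥ 1` and non-zero in `K`). SUPPOSE: for every index set `S` with `|S| ≥ 2` on which `a` and `b` are proportional (`aᵢbⱼ = aⱼbᵢ`, `i, j ∈ S`) and every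
torus point `q` with `Σ_S cᵢqᵢ^{aᵢ} = 0 = Σ_S dᵢqᵢ^{bᵢ}`, some minor `aᵢcᵢqᵢ^{aᵢ−1}·bⱼdⱼqⱼ^{bⱼ−1} ≠ aⱼcⱼqⱼ^{aⱼ−1}·bᵢdᵢqᵢ^{bᵢ−1}` (`i, j ∈ S`). THEN the pair is CI-Newton-non-degenerate
along every positive weight. (When the vertex sets `A(w) ≠ B(w)` differ the two gradient rows have different torus supports; a lone common vertex has no torus zero; a common
vertex set `S` forces proportional exponents on `S`.) [OURS · elementary; cite: CuetoPopescupampuStepanov2023, Def. 4.2 (p. 12); BoubakriGreuelMarkwig2010, §3 (p. 10)] -/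
theorem ciNondegenerate_of_faces (hn : 0 < n) (a b : Fin n → ℕ) (ha : ∀ i, a i ≠ 0) (hb : ∀ i, b i ≠ 0) (haK : ∀ i, ((a i : ℕ) : K) ≠ 0)
    (hbK : ∀ i, ((b i : ℕ) : K) ≠ 0) (c d : Fin n → K) (hc : ∀ i, c i ≠ 0) (hd : ∀ i, d i ≠ 0)
    (hface : ∀ S : Finset (Fin n), 2 ≤ S.card → (∀ i ∈ S, ∀ j ∈ S, a i * b j = a j * b i) →
      ∀ q : Fin n → K, (∀ i, q i ≠ 0) → ∑ i ∈ S, c i * q i ^ a i = 0 → ∑ i ∈ S, d i * q i ^ b i = 0 →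
        ∃ i ∈ S, ∃ j ∈ S, c i * ((a i : K) * q i ^ (a i - 1)) * (d j * ((b j : K) * q j ^ (b j - 1))) ≠
          c j * ((a j : K) * q j ^ (a j - 1)) * (d i * ((b i : K) * q i ^ (b i - 1))))
    (F : Fin 2 → MvPolynomial (Fin n) K) (hF0 : F 0 = ∑ i : Fin n, monomial (Finsupp.single i (a i)) (c i))
    (hF1 : F 1 = ∑ i : Fin n, monomial (Finsupp.single i (b i)) (d i)) :
    ∀ w : Fin n → ℝ, (∀ i, 0 < w i) → IsCINondegenerateAlong w (fun l => (F l : MvPowerSeries (Fin n) K)) := by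
  classical
  intro w hw q hq hzero
  -- the two faces and their vertex index sets
  obtain ⟨Φ₀, hΦ₀⟩ : ∃ Φ : Finset (Fin n →₀ ℕ), Φ = (∑ i : Fin n, monomial (Finsupp.single i (a i)) (c i)).support.filter
      (fun α => ∀ β ∈ (∑ i : Fin n, monomial (Finsupp.single i (a i)) (c i)).support, wdeg w α ≤ wdeg w β) := ⟨_, rfl⟩
  obtain ⟨Φ₁, hΦ₁⟩ : ∃ Φ : Finset (Fin n →₀ ℕ), Φ = (∑ i : Fin n, monomial (Finsupp.single i (b i)) (d i)).support.filter
      (fun α => ∀ β ∈ (∑ i : Fin n, monomial (Finsupp.single i (b i)) (d i)).support, wdeg w α ≤ wdeg w β) := ⟨_, rfl⟩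
  have hΦ₀sub : ∀ β ∈ Φ₀, ∃ i, β = Finsupp.single i (a i) := fun β hβ => by
    rw [hΦ₀, Finset.mem_filter] at hβ
    exact exists_eq_single_of_mem_support a c β hβ.1
  have hΦ₁sub : ∀ β ∈ Φ₁, ∃ i, β = Finsupp.single i (b i) := fun β hβ => by
    rw [hΦ₁, Finset.mem_filter] at hβ
    exact exists_eq_single_of_mem_support b d β hβ.1
  set S₀ : Finset (Fin n) := Finset.univ.filter fun i : Fin n => Finsupp.single i (a i) ∈ Φ₀ with hS₀
  set S₁ : Finset (Fin n) := Finset.univ.filter fun i : Fin n => Finsupp.single i (b i) ∈ Φ₁ with hS₁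
  have hmem₀ : ∀ i, i ∈ S₀ ↔ Finsupp.single i (a i) ∈ Φ₀ := fun i => by simp [hS₀]
  have hmem₁ : ∀ i, i ∈ S₁ ↔ Finsupp.single i (b i) ∈ Φ₁ := fun i => by simp [hS₁]
  have hin₀ : initialForm w (F 0 : MvPowerSeries (Fin n) K) =
      ((∑ α ∈ Φ₀, monomial α (coeff α (∑ i : Fin n, monomial (Finsupp.single i (a i)) (c i))) : MvPolynomial (Fin n) K) : MvPowerSeries (Fin n) K) := by
    rw [hF0, NewtonChartLemma.initialForm_coe_real _ w, hΦ₀]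
  have hin₁ : initialForm w (F 1 : MvPowerSeries (Fin n) K) =
      ((∑ α ∈ Φ₁, monomial α (coeff α (∑ i : Fin n, monomial (Finsupp.single i (b i)) (d i))) : MvPolynomial (Fin n) K) : MvPowerSeries (Fin n) K) := by
    rw [hF1, NewtonChartLemma.initialForm_coe_real _ w, hΦ₁]
  -- the vanishing of the two initial forms at `q`
  have hz₀ : ∑ i ∈ S₀, c i * q i ^ a i = 0 := by
    have h := hzero 0
    rwa [hin₀, NewtonChartLemma.evalAt_coe, eval_faceSum a ha c Φ₀ hΦ₀sub q] at h
  have hz₁ : ∑ i ∈ S₁, d i * q i ^ b i = 0 := by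
    have h := hzero 1
    rwa [hin₁, NewtonChartLemma.evalAt_coe, eval_faceSum b hb d Φ₁ hΦ₁sub q] at h
  -- the two gradient rows
  have hfam : (fun l : Fin 2 => fun i : Fin n => evalAt (MvPowerSeries.pderiv i (initialForm w (F l : MvPowerSeries (Fin n) K))) q) =
      ![fun m => if Finsupp.single m (a m) ∈ Φ₀ then c m * ((a m : K) * q m ^ (a m - 1)) else 0,
        fun m => if Finsupp.single m (b m) ∈ Φ₁ then d m * ((b m : K) * q m ^ (b m - 1)) else 0] := by
    funext l m
    fin_cases l
    · show evalAt (MvPowerSeries.pderiv m (initialForm w (F 0 : MvPowerSeries (Fin n) K))) q = _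
      rw [hin₀, NewtonChartLemma.pderiv_coe, NewtonChartLemma.evalAt_coe, eval_pderiv_faceSum_ite a ha c Φ₀ hΦ₀sub m q]
      rfl
    · show evalAt (MvPowerSeries.pderiv m (initialForm w (F 1 : MvPowerSeries (Fin n) K))) q = _
      rw [hin₁, NewtonChartLemma.pderiv_coe, NewtonChartLemma.evalAt_coe, eval_pderiv_faceSum_ite b hb d Φ₁ hΦ₁sub m q]
      rfl
  rw [hfam, LinearIndependent.pair_iff]
  intro s t hst
  have hcoord : ∀ m : Fin n, s * (if Finsupp.single m (a m) ∈ Φ₀ then c m * ((a m : K) * q m ^ (a m - 1)) else 0) +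
      t * (if Finsupp.single m (b m) ∈ Φ₁ then d m * ((b m : K) * q m ^ (b m - 1)) else 0) = 0 := by
    intro m
    have h := congr_fun hst m
    simpa only [Pi.add_apply, Pi.smul_apply, smul_eq_mul, Pi.zero_apply, Matrix.cons_val_zero, Matrix.cons_val_one] using h
  have hα : ∀ m, c m * ((a m : K) * q m ^ (a m - 1)) ≠ 0 := fun m => mul_ne_zero (hc m) (mul_ne_zero (haK m) (pow_ne_zero _ (hq m)))
  have hβ : ∀ m, d m * ((b m : K) * q m ^ (b m - 1)) ≠ 0 := fun m => mul_ne_zero (hd m) (mul_ne_zero (hbK m) (pow_ne_zero _ (hq m)))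
  -- both vertex sets are non-empty
  have hne₀ : S₀.Nonempty := by
    obtain ⟨α₁, hα₁, hmin⟩ := Finset.exists_min_image (∑ i : Fin n, monomial (Finsupp.single i (a i)) (c i)).support (fun α => wdeg w α)
      (MvPolynomial.support_nonempty.mpr (diag_ne_zero hn a ha c hc))
    have hα₁Φ : α₁ ∈ Φ₀ := by rw [hΦ₀, Finset.mem_filter]; exact ⟨hα₁, hmin⟩
    obtain ⟨i, rfl⟩ := hΦ₀sub α₁ hα₁Φ
    exact ⟨i, (hmem₀ i).mpr hα₁Φ⟩
  have hne₁ : S₁.Nonempty := by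
    obtain ⟨α₁, hα₁, hmin⟩ := Finset.exists_min_image (∑ i : Fin n, monomial (Finsupp.single i (b i)) (d i)).support (fun α => wdeg w α)
      (MvPolynomial.support_nonempty.mpr (diag_ne_zero hn b hb d hd))
    have hα₁Φ : α₁ ∈ Φ₁ := by rw [hΦ₁, Finset.mem_filter]; exact ⟨hα₁, hmin⟩
    obtain ⟨i, rfl⟩ := hΦ₁sub α₁ hα₁Φ
    exact ⟨i, (hmem₁ i).mpr hα₁Φ⟩
  -- `s = 0` forces `t = 0` and conversely (the rows are non-zero)
  have ht_of_s : s = 0 → t = 0 := fun hs0 => by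
    obtain ⟨m, hm⟩ := hne₁
    have h := hcoord m
    rw [hs0, zero_mul, zero_add, if_pos ((hmem₁ m).mp hm)] at h
    exact (mul_eq_zero.mp h).resolve_right (hβ m)
  have hs_of_t : t = 0 → s = 0 := fun ht0 => by
    obtain ⟨m, hm⟩ := hne₀
    have h := hcoord m
    rw [ht0, zero_mul, add_zero, if_pos ((hmem₀ m).mp hm)] at h
    exact (mul_eq_zero.mp h).resolve_right (hα m)
  by_cases hS : S₀ = S₁
  · -- common vertex set `S`
    rcases Nat.lt_or_ge S₀.card 2 with hlt | hge
    · -- a single common vertex has no torus zero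
      have hcard : S₀.card = 1 := by have := hne₀.card_pos; omega
      obtain ⟨i, hi⟩ := Finset.card_eq_one.mp hcard
      rw [hi, Finset.sum_singleton] at hz₀
      exact (mul_ne_zero (hc i) (pow_ne_zero _ (hq i)) hz₀).elim
    · -- proportional exponents on `S`, then the minor hypothesis
      have hprop : ∀ i ∈ S₀, ∀ j ∈ S₀, a i * b j = a j * b i := by
        intro i hi j hj
        have h₀ := weight_eq_of_mem_face a c w Φ₀ hΦ₀ i j ((hmem₀ i).mp hi) ((hmem₀ j).mp hj)
        have h₁ := weight_eq_of_mem_face b d w Φ₁ hΦ₁ i j ((hmem₁ i).mp (hS ▸ hi)) ((hmem₁ j).mp (hS ▸ hj))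
        have hwi := hw i
        have hwj := hw j
        have key : (w i * w j) * ((a i : ℝ) * b j) = (w i * w j) * ((a j : ℝ) * b i) := by
          linear_combination (w j * (b j : ℝ)) * h₀ - (w j * (a j : ℝ)) * h₁
        have h := mul_left_cancel₀ (mul_ne_zero hwi.ne' hwj.ne') key
        exact_mod_cast h
      rw [← hS] at hz₁
      obtain ⟨i, hi, j, hj, hM⟩ := hface S₀ hge hprop q hq hz₀ hz₁
      have h_i := hcoord i
      have h_j := hcoord j
      rw [if_pos ((hmem₀ i).mp hi), if_pos ((hmem₁ i).mp (hS ▸ hi))] at h_i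
      rw [if_pos ((hmem₀ j).mp hj), if_pos ((hmem₁ j).mp (hS ▸ hj))] at h_j
      have hs : s * (c i * ((a i : K) * q i ^ (a i - 1)) * (d j * ((b j : K) * q j ^ (b j - 1))) -
          c j * ((a j : K) * q j ^ (a j - 1)) * (d i * ((b i : K) * q i ^ (b i - 1)))) = 0 := by
        linear_combination (d j * ((b j : K) * q j ^ (b j - 1))) * h_i - (d i * ((b i : K) * q i ^ (b i - 1))) * h_j
      have hs0 : s = 0 := (mul_eq_zero.mp hs).resolve_right (sub_ne_zero.mpr hM)
      exact ⟨hs0, ht_of_s hs0⟩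
  · -- different vertex sets: a column seen by exactly one row
    have hnot : ¬ (S₀ ⊆ S₁ ∧ S₁ ⊆ S₀) := fun h => hS (Finset.Subset.antisymm h.1 h.2)
    rcases not_and_or.mp hnot with h₀ | h₁
    · obtain ⟨m, hm₀, hm₁⟩ := Finset.not_subset.mp h₀
      have h := hcoord m
      rw [if_pos ((hmem₀ m).mp hm₀), if_neg (fun h' => hm₁ ((hmem₁ m).mpr h')), mul_zero, add_zero] at h
      have hs0 : s = 0 := (mul_eq_zero.mp h).resolve_right (hα m)
      exact ⟨hs0, ht_of_s hs0⟩
    · obtain ⟨m, hm₁, hm₀⟩ := Finset.not_subset.mp h₁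
      have h := hcoord m
      rw [if_neg (fun h' => hm₀ ((hmem₀ m).mpr h')), if_pos ((hmem₁ m).mp hm₁), mul_zero, zero_add] at h
      have ht0 : t = 0 := (mul_eq_zero.mp h).resolve_right (hβ m)
      exact ⟨hs_of_t ht0, ht0⟩

/-! ## §3 The Jacobian minor; no variable vanishes on `V(F₀, F₁)` -/

/-- The `2 × 2` Jacobian minor of `(Σ cᵢxᵢ^{aᵢ}, Σ dᵢxᵢ^{bᵢ})` on the columns `(i, j)`. [folklore] -/
theorem det_pair_general (a b : Fin n → ℕ) (c d : Fin n → K) (F : Fin 2 → MvPolynomial (Fin n) K)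
    (hF0 : F 0 = ∑ i : Fin n, monomial (Finsupp.single i (a i)) (c i)) (hF1 : F 1 = ∑ i : Fin n, monomial (Finsupp.single i (b i)) (d i))
    (i j : Fin n) :
    (Matrix.of fun μ l => (![(pderiv i).restrictScalars ℤ, (pderiv j).restrictScalars ℤ] :
        Fin 2 → Derivation ℤ (MvPolynomial (Fin n) K) (MvPolynomial (Fin n) K)) μ (F l)).det =
      C (c i * (a i : ℕ)) * X i ^ (a i - 1) * (C (d j * (b j : ℕ)) * X j ^ (b j - 1)) -
        C (c j * (a j : ℕ)) * X j ^ (a j - 1) * (C (d i * (b i : ℕ)) * X i ^ (b i - 1)) := by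
  rw [Matrix.det_fin_two]
  simp only [Matrix.of_apply, Matrix.cons_val_zero, Matrix.cons_val_one, Derivation.restrictScalars_apply, hF0, hF1, pderiv_diag]
  simp only [← C_mul_X_pow_eq_monomial]
  ring

/-- ★ **`x̄ᵥ ≠ 0` in `k[x]/(F₀, F₁)`** when all `aᵢ, bᵢ ≥ 2`. [folklore] -/
theorem mk_X_ne_zero_pair_general (a b : Fin n → ℕ) (ha2 : ∀ i, 2 ≤ a i) (hb2 : ∀ i, 2 ≤ b i) (c d : Fin n → K) (F : Fin 2 → MvPolynomial (Fin n) K)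
    (hF0 : F 0 = ∑ i : Fin n, monomial (Finsupp.single i (a i)) (c i)) (hF1 : F 1 = ∑ i : Fin n, monomial (Finsupp.single i (b i)) (d i))
    (v : Fin n) : Ideal.Quotient.mk (Ideal.span (Set.range F)) (X v) ≠ 0 := by
  classical
  intro h0
  rw [Ideal.Quotient.eq_zero_iff_mem, Ideal.mem_span_range_iff_exists_fun] at h0
  obtain ⟨g, hg⟩ := h0
  have h := congrArg (coeff (Finsupp.single v 1)) hg
  rw [coeff_sum, Fin.sum_univ_two, hF0, hF1, coeff_single_one_mul_diag a ha2 c (g 0) v, coeff_single_one_mul_diag b hb2 d (g 1) v, add_zero,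
    coeff_X] at h
  simp at h

/-! ## §4 ★ Regularity off the vertex from the support truncations over every field -/

set_option maxHeartbeats 800000 in
-- one passage to the residue field `κ(Q)`
/-- ★ **`(k[x]/(F₀, F₁))_Q` IS REGULAR AT EVERY PRIME `Q ⊉ (x̄)`** (`F₀ = Σ cᵢxᵢ^{aᵢ}`, `F₁ = Σ dᵢxᵢ^{bᵢ}`, all exponents `≥ 2`) PROVIDED: for every field `L` over `k`,
every non-empty index set `S` and every `ξ ∈ Lⁿ` with `ξᵢ ≠ 0` (`i ∈ S`) and `Σ_S cᵢξᵢ^{aᵢ} = 0 = Σ_S dᵢξᵢ^{bᵢ}`, some minor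
`aᵢcᵢξᵢ^{aᵢ−1}·bⱼdⱼξⱼ^{bⱼ−1} ≠ aⱼcⱼξⱼ^{aⱼ−1}·bᵢdᵢξᵢ^{bᵢ−1}` (`i, j ∈ S`). Proof: `L = κ(Q)`, `ξ = x̄`, `S = {i : x̄ᵢ ∉ Q}`; the columns off `S` die (exponents
`≥ 2`), the surviving minor is off `Q`, and ✓`CIJacobian.ci_clause_of_det_not_mem` concludes. [OURS · elementary certificate; cite: Matsumura1987, Thm. 30.4 (ii) and Thm. 14.2] -/
theorem isRegularLocalRing_off_vertex_of_points (p : ℕ) [Fact p.Prime] {k : Type} [Field k] [CharP k p] (a b : Fin n → ℕ)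
    (ha2 : ∀ i, 2 ≤ a i) (hb2 : ∀ i, 2 ≤ b i) (c d : Fin n → k) (F : Fin 2 → MvPolynomial (Fin n) k)
    (hF0 : F 0 = ∑ i : Fin n, monomial (Finsupp.single i (a i)) (c i)) (hF1 : F 1 = ∑ i : Fin n, monomial (Finsupp.single i (b i)) (d i))
    (hpt : ∀ (L : Type) [Field L] (φ : k →+* L) (S : Finset (Fin n)), S.Nonempty → ∀ ξ : Fin n → L, (∀ i ∈ S, ξ i ≠ 0) → (∀ i ∉ S, ξ i = 0) →
      ∑ i ∈ S, φ (c i) * ξ i ^ a i = 0 → ∑ i ∈ S, φ (d i) * ξ i ^ b i = 0 →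
        ∃ i ∈ S, ∃ j ∈ S, φ (c i) * ((a i : L) * ξ i ^ (a i - 1)) * (φ (d j) * ((b j : L) * ξ j ^ (b j - 1))) ≠
          φ (c j) * ((a j : L) * ξ j ^ (a j - 1)) * (φ (d i) * ((b i : L) * ξ i ^ (b i - 1))))
    (Q : Ideal (MvPolynomial (Fin n) k ⧸ Ideal.span (Set.range F))) [Q.IsPrime]
    (hQ : ¬ Ideal.span (Set.range fun j : Fin n => Ideal.Quotient.mk (Ideal.span (Set.range F)) (X j)) ≤ Q) :
    IsRegularLocalRing (Localization.AtPrime Q) := by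
  classical
  let ψ : MvPolynomial (Fin n) k →+* Q.ResidueField :=
    (algebraMap (MvPolynomial (Fin n) k ⧸ Ideal.span (Set.range F)) Q.ResidueField).comp (Ideal.Quotient.mk (Ideal.span (Set.range F)))
  -- `ψ f = 0 ↔ f̄ ∈ Q`
  have hker : ∀ f, ψ f = 0 ↔ Ideal.Quotient.mk (Ideal.span (Set.range F)) f ∈ Q := fun f => by
    simp only [ψ, RingHom.comp_apply, Ideal.algebraMap_residueField_eq_zero]
  let φ : k →+* Q.ResidueField := ψ.comp C
  let ξ : Fin n → Q.ResidueField := fun i => ψ (X i)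
  let S : Finset (Fin n) := Finset.univ.filter fun i => ξ i ≠ 0
  have hSmem : ∀ i, i ∈ S ↔ ξ i ≠ 0 := fun i => by simp [S]
  have hSne : S.Nonempty := by
    by_contra h
    rw [Finset.not_nonempty_iff_eq_empty] at h
    apply hQ
    rw [Ideal.span_le]
    rintro _ ⟨j, rfl⟩
    have hj : ξ j = 0 := by
      by_contra hne
      have : j ∈ S := (hSmem j).mpr hne
      rw [h] at this
      exact Finset.notMem_empty j this
    exact (hker (X j)).mp hj
  -- `ψ` of a diagonal polynomial is its truncated value at `ξ`
  have hdiag : ∀ (e : Fin n → ℕ) (he : ∀ i, e i ≠ 0) (r : Fin n → k),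
      ψ (∑ i : Fin n, monomial (Finsupp.single i (e i)) (r i)) = ∑ i ∈ S, φ (r i) * ξ i ^ e i := by
    intro e he r
    rw [map_sum, ← Finset.sum_filter_add_sum_filter_not Finset.univ (fun i => ξ i ≠ 0)]
    have hzero : ∑ i ∈ Finset.univ.filter (fun i => ¬ ξ i ≠ 0), ψ (monomial (Finsupp.single i (e i)) (r i)) = 0 := by
      refine Finset.sum_eq_zero fun i hi => ?_
      rw [Finset.mem_filter, not_not] at hi
      rw [← C_mul_X_pow_eq_monomial, map_mul, map_pow, show ψ (X i) = ξ i from rfl, hi.2, zero_pow (he i), mul_zero]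
    rw [hzero, add_zero]
    refine Finset.sum_congr rfl fun i _ => ?_
    rw [← C_mul_X_pow_eq_monomial, map_mul, map_pow]
    rfl
  have hF : ∀ l, ψ (F l) = 0 := fun l => by
    have h0 : Ideal.Quotient.mk (Ideal.span (Set.range F)) (F l) = 0 := Ideal.Quotient.eq_zero_iff_mem.mpr (Ideal.subset_span ⟨l, rfl⟩)
    rw [hker, h0]
    exact Q.zero_mem
  have hz₀ : ∑ i ∈ S, φ (c i) * ξ i ^ a i = 0 := by
    rw [← hdiag a (fun i => by have := ha2 i; omega) c, ← hF0]; exact hF 0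
  have hz₁ : ∑ i ∈ S, φ (d i) * ξ i ^ b i = 0 := by
    rw [← hdiag b (fun i => by have := hb2 i; omega) d, ← hF1]; exact hF 1
  obtain ⟨i, hi, j, hj, hM⟩ := hpt Q.ResidueField φ S hSne ξ (fun i hi => (hSmem i).mp hi) (fun i hi => by
    by_contra hne; exact hi ((hSmem i).mpr hne)) hz₀ hz₁
  -- the minor on the columns `(i, j)` is off `Q`
  have hndet : (Matrix.of fun μ l => (![(pderiv i).restrictScalars ℤ, (pderiv j).restrictScalars ℤ] :
      Fin 2 → Derivation ℤ (MvPolynomial (Fin n) k) (MvPolynomial (Fin n) k)) μ (F l)).det ∉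
        Q.comap (Ideal.Quotient.mk (Ideal.span (Set.range F))) := by
    rw [Ideal.mem_comap, det_pair_general a b c d F hF0 hF1 i j, ← hker]
    intro h0
    apply hM
    rw [map_sub, sub_eq_zero] at h0
    simp only [map_mul, map_pow, map_natCast] at h0
    change ψ (C (c i)) * (((a i : ℕ) : Q.ResidueField) * ψ (X i) ^ (a i - 1)) * (ψ (C (d j)) * (((b j : ℕ) : Q.ResidueField) * ψ (X j) ^ (b j - 1))) =
      ψ (C (c j)) * (((a j : ℕ) : Q.ResidueField) * ψ (X j) ^ (a j - 1)) * (ψ (C (d i)) * (((b i : ℕ) : Q.ResidueField) * ψ (X i) ^ (b i - 1)))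
    linear_combination h0
  exact (CIJacobian.ci_clause_of_det_not_mem p k n 2 F Q _ hndet).1

end Summit.ResolutionOfSingularities.ResolutionOfSingularities.Theorems.FInjectiveMacaulayfication.DiagonalPairTruncations

end
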